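import Literature.NumberTheory.EllipticCurves.CyclotomicTowerLocalFrobeniusProofs
import Literature.NumberTheory.EllipticCurves.SpectralValuationUnramified
import Mathlib.NumberTheory.Cyclotomic.CyclotomicCharacter
import HarnessLib

/-!
# The inertia group has finite index in the local cyclotomic Galois group: at ANY place `v ∣ p`
# of a number field, `ι · σ^e` fixes every `p`-power root of unity for some inertia element `ι`
# (`e` = the ramification index of `v` over `p`)

`Proofs` file (theorems only: no definition, no named fact, no instance, no `sorry`) in topic
`NumberTheory/EllipticCurves`; the RAMIFIED companion of `CyclotomicTowerLocalFrobeniusProofs.lean`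
(seat `bsd-potss-rkm` g32, cell `bsd-potss`; a brick of the kernel proof of Imai's finiteness
`E(ℚ_{p,∞})[p^∞] < ∞` on the potentially ORDINARY additive rows, where the field of good reduction
`F_w/ℚ_p` is ramified).  The unramified file proves, when `p` is a uniformiser of `𝓞_v`, that the
inertia group `I_𝔐 ≤ Γ_{K_v}` acts TRANSITIVELY on the primitive `pⁿ`-th roots of unity
(`K_v(μ_{pⁿ})/K_v` totally ramified) and deduces an arithmetic Frobenius fixing `μ_{p^∞}`.  At a
place `v` of ramification index `e = e(v ∣ p)` (`|p|_v = |ϖ|_v^e`) total ramification fails, but the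
same valuation count bounds the failure:

* `exists_one_le_spectralValuation_prime_eq_pow` — `|p|_v = |ϖ|_v^e` with `e ≥ 1`;
* `exists_mem_inertia_smul_eq_pow_smul_of_isPrimitiveRoot` — **the image of `I_𝔐` in
  `Gal(K_v(μ_{pⁿ})/K_v) ↪ (ℤ/pⁿ)ˣ` has index dividing `e`**: for every `σ ∈ Γ_{K_v}` and every
  primitive `pⁿ`-th root of unity `ζ` there is `ι ∈ I_𝔐` with `ι ζ = σ^e ζ`.  Proof: the inertia
  orbit `O` of `ζ` is the orbit of the subgroup `Ī = χ̄_{pⁿ}(I_𝔐) ≤ (ℤ/pⁿ)ˣ` (Mathlib's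
  `modularCyclotomicCharacter`), so `#O = #Ī =: d`; `g = ∏_{η ∈ O} (1 - η)` lies in the inertia field,
  so `|g|_v = |ϖ|_v^m` (`exists_spectralValuation_eq_pow_of_forall_inertia`); with `|1 - η|_v = |1 - ζ|_v`
  on `O` and `|1 - ζ|_v^{φ(pⁿ)} = |p|_v = |ϖ|_v^e` this gives `m·φ(pⁿ) = e·d`, i.e. the index
  `φ(pⁿ)/d` of `Ī` divides `e` (Lagrange), whence `χ̄(σ)^e ∈ Ī` (`Subgroup.pow_index_mem`);
* `exists_mem_inertia_forall_smul_rootOfUnity_eq_pow_smul` — by compactness (Cantor's intersection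
  theorem in the closed inertia group, along a compatible system `ζ_{p^{n+1}}^p = ζ_{pⁿ}`, exactly as
  in the unramified file) ONE `ι ∈ I_𝔐` works for all `n`: `ι ξ = σ^e ξ` for every `p`-power root of
  unity `ξ`;
* `exists_forall_exists_mem_inertia_mul_pow_smul_rootOfUnity_eq` — packaged: **there is `e ≥ 1`
  (the ramification index) such that for every `σ ∈ Γ_{K_v}` some `ι ∈ I_𝔐` makes `ι·σ^e` fix
  every `p`-power root of unity of `K̄_v`**.  With `σ` an arithmetic Frobenius this is an element of
  `Γ_{K_v}` of Frobenius degree `e` and cyclotomic character `1` — i.e. the maximal unramified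
  subextension of `K_v(μ_{p^∞})/K_v` is FINITE, of degree dividing `e` (Neukirch, *ANT*, II (7.13);
  Serre, *Local Fields*, IV §4; Washington, *Cyclotomic Fields*, §13.1 for `e = 1`).

## References

* [NeukirchANT1999] J. Neukirch, *Algebraic Number Theory* (1999), Ch. II (7.12)–(7.13), §9.
* [SerreLocalFields1979] J.-P. Serre, *Local Fields* (1979), IV §4 Prop. 17–18.
* [Washington1997] L. C. Washington, *Introduction to Cyclotomic Fields*, 2nd ed., §13.1.
* Tree: `CyclotomicTowerLocalFrobeniusProofs.lean` (the case `e = 1`, whose bricks are reused),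
  `SpectralValuationUnramified.lean` (`exists_spectralValuation_eq_pow_of_forall_inertia`).
-/

noncomputable section

open scoped Classical NNReal Pointwise
open NumberField IsDedekindDomain

universe u

namespace IsDedekindDomain.HeightOneSpectrum

open Literature.NumberTheory.EllipticCurves Literature.NumberTheory.GaloisRepresentations Field
  Literature.NumberTheory.EllipticCurves.TwistedKummer
  Literature.NumberTheory.GaloisRepresentations.IsNonarchimedeanLocalField

variable {K : Type u} [Field K] [NumberField K] {v : HeightOneSpectrum (𝓞 K)}
  {w : Valuation (AlgebraicClosure (v.adicCompletion K)) ℝ≥0}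
  (hw : ∀ x, (w x : ℝ) = spectralNorm (v.adicCompletion K) (AlgebraicClosure (v.adicCompletion K)) x)
  {𝔐 : Ideal v.localAbsIntegers} (h𝔐 : 𝔐 ∈ v.localPrimesAbove)
  {p : ℕ} [hp : Fact p.Prime] (hpv : (p : 𝓞 K) ∈ v.asIdeal)

/-! ## §1 The ramification index: `|p|_v = |ϖ|_v^e`, `e ≥ 1` -/

include hw hpv in
/-- **`|p|_v = |ϖ|_v^e` with `e ≥ 1`** for a uniformiser `ϖ` of `𝓞_v` at a place `v ∣ p` (`e` is
the ramification index `e(v ∣ p)`; discreteness of `|K_vˣ|_v`). [cite: NeukirchANT1999, Ch. II (3.8)–(4.8)] -/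
theorem exists_one_le_spectralValuation_prime_eq_pow {ϖ : v.adicCompletionIntegers K}
    (hϖ : Irreducible ϖ) :
    ∃ e : ℕ, 1 ≤ e ∧ w (p : AlgebraicClosure (v.adicCompletion K)) =
      w (algebraMap (v.adicCompletion K) (AlgebraicClosure (v.adicCompletion K))
        (ϖ : v.adicCompletion K)) ^ e := by
  obtain ⟨hp1, hp0⟩ := spectralValuation_natCast_prime_lt_one_and_pos (p := p) hw hpv
  have e1 : algebraMap (v.adicCompletion K) (AlgebraicClosure (v.adicCompletion K))
      (p : v.adicCompletion K) = (p : AlgebraicClosure (v.adicCompletion K)) := map_natCast _ p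
  obtain ⟨e, he, h⟩ := exists_spectralValuation_algebraMap_eq_pow hw hϖ (a := (p : v.adicCompletion K))
    (by rw [e1]; exact hp0) (by rw [e1]; exact hp1)
  exact ⟨e, he, by rw [← e1]; exact h⟩

/-! ## §2 The inertia image in `Gal(K_v(μ_{pⁿ})/K_v)` has index dividing `e` -/

include hw h𝔐 hpv in
/-- **The image of the inertia group in `Gal(K_v(μ_{pⁿ})/K_v) ↪ (ℤ/pⁿ)ˣ` has index dividing the
ramification index `e`**: if `|p|_v = |ϖ|_v^e`, then for every `σ ∈ Γ_{K_v}` and every primitive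
`p^{n+1}`-th root of unity `ζ` there is `ι ∈ I_𝔐` with `ι ζ = σ^e ζ`.  The inertia orbit of `ζ` is the
orbit of `Ī = χ̄(I_𝔐) ≤ (ℤ/p^{n+1})ˣ`, of size `d = #Ī`; `∏_{η ∈ O} (1 - η)` lies in the inertia field
and has value `|1 - ζ|_v^d = |ϖ|_v^m`, while `|1 - ζ|_v^{φ} = |p|_v = |ϖ|_v^e`, so `m φ = e d` and the
index `φ/d` of `Ī` divides `e`; hence `χ̄(σ)^e ∈ Ī`. Neukirch, *ANT*, II (7.12)–(7.13); Serre, *Local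
Fields*, IV §4. [cite: NeukirchANT1999, Ch. II (7.13)] [cite: SerreLocalFields1979, Ch. IV §4 Prop. 17] -/
theorem exists_mem_inertia_smul_eq_pow_smul_of_isPrimitiveRoot {ϖ : v.adicCompletionIntegers K}
    (hϖ : Irreducible ϖ) {e : ℕ}
    (he : w (p : AlgebraicClosure (v.adicCompletion K)) =
      w (algebraMap (v.adicCompletion K) (AlgebraicClosure (v.adicCompletion K))
        (ϖ : v.adicCompletion K)) ^ e)
    (n : ℕ) {ζ : AlgebraicClosure (v.adicCompletion K)} (hζ : IsPrimitiveRoot ζ (p ^ (n + 1)))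
    (σ : absoluteGaloisGroup (v.adicCompletion K)) :
    ∃ ι ∈ 𝔐.inertia (absoluteGaloisGroup (v.adicCompletion K)), ι • ζ = σ ^ e • ζ := by
  obtain ⟨hp1, hp0⟩ := spectralValuation_natCast_prime_lt_one_and_pos (p := p) hw hpv
  obtain ⟨hϖ0, hϖ1⟩ := spectralValuation_uniformizer_pos_lt_one hw hϖ
  have hpp := hp.out
  set N : ℕ := p ^ (n + 1) with hNdef
  have hN0 : 0 < N := pow_pos hpp.pos _
  have hN1 : 1 < N := Nat.one_lt_pow (by omega) hpp.one_lt
  haveI : NeZero N := ⟨hN0.ne'⟩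
  haveI : CharZero (v.adicCompletion K) :=
    charZero_of_injective_algebraMap (algebraMap K (v.adicCompletion K)).injective
  haveI : CharZero (AlgebraicClosure (v.adicCompletion K)) := charZero_of_injective_algebraMap
    (algebraMap (v.adicCompletion K) (AlgebraicClosure (v.adicCompletion K))).injective
  haveI : NeZero ((N : ℕ) : AlgebraicClosure (v.adicCompletion K)) := ⟨by exact_mod_cast hN0.ne'⟩
  set I : Subgroup (absoluteGaloisGroup (v.adicCompletion K)) :=
    𝔐.inertia (absoluteGaloisGroup (v.adicCompletion K)) with hIdef
  -- the mod-`N` cyclotomic character of `Γ_{K_v}` on `K̄_v`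
  have hcardμ : Nat.card (rootsOfUnity N (AlgebraicClosure (v.adicCompletion K))) = N :=
    HasEnoughRootsOfUnity.natCard_rootsOfUnity (AlgebraicClosure (v.adicCompletion K)) N
  set c : absoluteGaloisGroup (v.adicCompletion K) →* (ZMod N)ˣ :=
    (modularCyclotomicCharacter (AlgebraicClosure (v.adicCompletion K)) hcardμ).comp
      (MulSemiringAction.toRingEquiv (absoluteGaloisGroup (v.adicCompletion K))
        (AlgebraicClosure (v.adicCompletion K))) with hcdef
  have hc : ∀ (τ : absoluteGaloisGroup (v.adicCompletion K)) (t : AlgebraicClosure (v.adicCompletion K)),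
      t ^ N = 1 → τ • t = t ^ ((c τ : ZMod N).val) := by
    intro τ t ht
    have h := modularCyclotomicCharacter.spec (AlgebraicClosure (v.adicCompletion K)) hcardμ
      (MulSemiringAction.toRingEquiv (absoluteGaloisGroup (v.adicCompletion K))
        (AlgebraicClosure (v.adicCompletion K)) τ)
      (t := (rootsOfUnity.mkOfPowEq t ht : (AlgebraicClosure (v.adicCompletion K))ˣ))
      (rootsOfUnity.mkOfPowEq t ht).2
    rw [hcdef, MonoidHom.comp_apply]
    simpa only [rootsOfUnity.val_mkOfPowEq_coe, MulSemiringAction.toRingEquiv_apply_apply] using h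
  -- `u ↦ ζ^u` is injective on `(ℤ/N)ˣ`
  have hinj : Function.Injective fun u : (ZMod N)ˣ ↦ ζ ^ (u : ZMod N).val := by
    intro a b hab
    dsimp only at hab
    have h := hζ.pow_inj (ZMod.val_lt _) (ZMod.val_lt _) hab
    exact Units.ext (ZMod.val_injective _ h)
  -- the inertia orbit of `ζ` is the orbit of `Ī = c(I)`
  set Ibar : Subgroup (ZMod N)ˣ := I.map c with hIbar
  set T : Finset (ZMod N)ˣ := Finset.univ.filter (fun u ↦ u ∈ Ibar) with hTdef
  set O : Finset (AlgebraicClosure (v.adicCompletion K)) := T.image (fun u : (ZMod N)ˣ ↦ ζ ^ (u : ZMod N).val) with hOdef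
  have hOmem : ∀ η, η ∈ O ↔ ∃ ι ∈ I, ι • ζ = η := by
    intro η
    rw [hOdef, Finset.mem_image]
    constructor
    · rintro ⟨u, hu, rfl⟩
      rw [hTdef, Finset.mem_filter] at hu
      obtain ⟨ι, hι, hιu⟩ := Subgroup.mem_map.mp hu.2
      exact ⟨ι, hι, by rw [hc ι ζ hζ.pow_eq_one, hιu]⟩
    · rintro ⟨ι, hι, rfl⟩
      refine ⟨c ι, ?_, (hc ι ζ hζ.pow_eq_one).symm⟩
      rw [hTdef, Finset.mem_filter]
      exact ⟨Finset.mem_univ _, Subgroup.mem_map.mpr ⟨ι, hι, rfl⟩⟩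
  have hOprim : ∀ η ∈ O, IsPrimitiveRoot η N := by
    intro η hη
    obtain ⟨ι, -, rfl⟩ := (hOmem η).mp hη
    exact isPrimitiveRoot_smul hζ ι
  have hζO : ζ ∈ O := (hOmem ζ).mpr ⟨1, I.one_mem, one_smul _ _⟩
  have hOcard : O.card = Nat.card Ibar := by
    rw [hOdef, Finset.card_image_of_injective _ hinj, hTdef, Nat.card_eq_fintype_card,
      Fintype.card_subtype]
  -- `O` is stable under every `τ ∈ I`
  have hstab : ∀ τ ∈ I, O.image (fun η ↦ τ • η) = O := by
    intro τ hτ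
    apply Finset.eq_of_subset_of_card_le
    · intro η hη
      obtain ⟨η', hη', rfl⟩ := Finset.mem_image.mp hη
      obtain ⟨ι, hι, rfl⟩ := (hOmem η').mp hη'
      exact (hOmem _).mpr ⟨τ * ι, I.mul_mem hτ hι, mul_smul τ ι ζ⟩
    · rw [Finset.card_image_of_injective _ (MulAction.injective τ)]
  -- `g = ∏_{η ∈ O} (1 - η)` is fixed by `I` and non-zero
  set g : AlgebraicClosure (v.adicCompletion K) := ∏ η ∈ O, (1 - η) with hgdef
  have hgfix : ∀ τ ∈ I, τ • g = g := by
    intro τ hτ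
    rw [hgdef, ← MulSemiringAction.toRingHom_apply _ _ τ, map_prod]
    simp only [map_sub, map_one, MulSemiringAction.toRingHom_apply]
    rw [← Finset.prod_image (s := O) (g := fun η ↦ τ • η) (f := fun η ↦ 1 - η)
      (fun a _ b _ h ↦ MulAction.injective τ h), hstab τ hτ]
  have hg0 : g ≠ 0 := by
    rw [hgdef, Finset.prod_ne_zero_iff]
    intro η hη h0
    have hη1 : η = 1 := (sub_eq_zero.mp h0).symm
    have hprim := hOprim η hη
    rw [hη1] at hprim
    exact absurd (hprim.eq_orderOf.trans orderOf_one) hN1.ne'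
  -- valuations
  set d : ℕ := O.card with hddef
  set φ : ℕ := Nat.totient N with hφdef
  set q : ℝ≥0 := w (algebraMap (v.adicCompletion K) (AlgebraicClosure (v.adicCompletion K))
    (ϖ : v.adicCompletion K)) with hqdef
  have hval_g : w g = w (1 - ζ) ^ d := by
    rw [hgdef, map_prod, ← Finset.prod_const]
    refine Finset.prod_congr rfl fun η hη ↦ ?_
    exact val_one_sub_eq_of_isPrimitiveRoot (hOprim η hη) hζ hN0.ne'
  have hval_ζ : w (1 - ζ) ^ φ = w (p : AlgebraicClosure (v.adicCompletion K)) :=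
    val_one_sub_pow_totient_eq n hζ
  have hφpos : 0 < φ := Nat.totient_pos.mpr hN0
  have hdpos : 0 < d := Finset.card_pos.mpr ⟨ζ, hζO⟩
  have h1ζ_lt : w (1 - ζ) < 1 := by
    by_contra hle
    have h1 : 1 ≤ w (1 - ζ) ^ φ := one_le_pow₀ (not_lt.mp hle)
    rw [hval_ζ] at h1
    exact absurd hp1 (not_lt.mpr h1)
  have h1ζ_pos : 0 < w (1 - ζ) := by
    rw [Valuation.pos_iff]
    intro h0
    have hζ1 : ζ = 1 := (sub_eq_zero.mp h0).symm
    rw [hζ1] at hζ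
    exact absurd (hζ.eq_orderOf.trans orderOf_one) hN1.ne'
  have hg_lt : w g < 1 := by rw [hval_g]; exact pow_lt_one₀ zero_le h1ζ_lt hdpos.ne'
  have hg_pos : 0 < w g := by rw [hval_g]; exact pow_pos h1ζ_pos _
  obtain ⟨m, -, hm⟩ := exists_spectralValuation_eq_pow_of_forall_inertia hw h𝔐 hϖ
    (fun τ hτ ↦ hgfix τ hτ) hg_pos hg_lt
  -- `m φ = e d`
  have hq1 : q ≠ 1 := hϖ1.ne
  have hmφ : m * φ = e * d := by
    apply pow_right_injective₀ hϖ0 hq1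
    dsimp only
    rw [pow_mul, ← hm, hval_g, ← pow_mul, mul_comm d φ, pow_mul, hval_ζ, he, ← pow_mul]
  -- Lagrange in `(ℤ/N)ˣ`: `d * index = φ`, so the index divides `e`
  have hLag : d * Ibar.index = φ := by
    rw [hOcard, Subgroup.card_mul_index, Nat.card_eq_fintype_card, ZMod.card_units_eq_totient]
  have hidx : Ibar.index ∣ e := by
    refine ⟨m, ?_⟩
    have h2 : d * e = d * (Ibar.index * m) := by
      calc d * e = e * d := mul_comm _ _
        _ = m * φ := hmφ.symm
        _ = m * (d * Ibar.index) := by rw [hLag]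
        _ = d * (Ibar.index * m) := by ring
    exact Nat.eq_of_mul_eq_mul_left hdpos h2
  -- hence `c(σ)^e ∈ Ī`, i.e. `c(σ^e) = c(ι)` for some `ι ∈ I`
  have hmemI : c (σ ^ e) ∈ Ibar := by
    obtain ⟨t, ht⟩ := hidx
    rw [map_pow, ht, pow_mul]
    exact Ibar.pow_mem (Subgroup.pow_index_mem Ibar (c σ)) t
  obtain ⟨ι, hι, hιc⟩ := Subgroup.mem_map.mp hmemI
  refine ⟨ι, hι, ?_⟩
  rw [hc ι ζ hζ.pow_eq_one, hc (σ ^ e) ζ hζ.pow_eq_one, hιc]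

/-! ## §3 One inertia element for all `p`-power roots of unity (compactness) -/

include hw h𝔐 hpv in
/-- **One inertia element matching `σ^e` on ALL `p`-power roots of unity**: if `|p|_v = |ϖ|_v^e`,
then for every `σ ∈ Γ_{K_v}` there is `ι ∈ I_𝔐` with `ι ξ = σ^e ξ` for every `ξ ∈ K̄_v` with
`ξ^{p^k} = 1`.  Along a compatible system `ζ_{p^{n+1}}^p = ζ_{pⁿ}` the sets `{ι ∈ I_𝔐 | ι ζ_n = σ^e ζ_n}`
are closed, non-empty (§2) and decreasing in the compact group `Γ_{K_v}` (Cantor), as in the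
unramified file. [cite: NeukirchANT1999, Ch. II (7.13)] [cite: Washington1997, §13.1] -/
theorem exists_mem_inertia_forall_smul_rootOfUnity_eq_pow_smul {ϖ : v.adicCompletionIntegers K}
    (hϖ : Irreducible ϖ) {e : ℕ}
    (he : w (p : AlgebraicClosure (v.adicCompletion K)) =
      w (algebraMap (v.adicCompletion K) (AlgebraicClosure (v.adicCompletion K))
        (ϖ : v.adicCompletion K)) ^ e)
    (σ : absoluteGaloisGroup (v.adicCompletion K)) :
    ∃ ι ∈ 𝔐.inertia (absoluteGaloisGroup (v.adicCompletion K)),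
      ∀ (k : ℕ) (ξ : AlgebraicClosure (v.adicCompletion K)), ξ ^ p ^ k = 1 → ι • ξ = σ ^ e • ξ := by
  haveI : CharZero (v.adicCompletion K) :=
    charZero_of_injective_algebraMap (algebraMap K (v.adicCompletion K)).injective
  haveI : CharZero (AlgebraicClosure (v.adicCompletion K)) := charZero_of_injective_algebraMap
    (algebraMap (v.adicCompletion K) (AlgebraicClosure (v.adicCompletion K))).injective
  have hpp := hp.out
  set I : Subgroup (absoluteGaloisGroup (v.adicCompletion K)) :=
    𝔐.inertia (absoluteGaloisGroup (v.adicCompletion K)) with hIdef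
  obtain ⟨z, hz, hzp⟩ : ∃ z : ℕ → AlgebraicClosure (v.adicCompletion K),
      (∀ n, IsPrimitiveRoot (z n) (p ^ (n + 1))) ∧ ∀ n, z (n + 1) ^ p = z n :=
    exists_compatible_primitiveRoots
  -- the roots as local absolute integers
  have hz1 : ∀ n, w (z n) ≤ 1 := fun n ↦
    (val_eq_one_of_pow_eq_one w (pow_ne_zero _ hpp.ne_zero) (hz n).pow_eq_one).le
  let b : ℕ → localAbsIntegers v := fun n ↦
    ⟨z n, (mem_localAbsIntegers_iff_spectralValuation hw).mpr (hz1 n)⟩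
  have hb : ∀ (n : ℕ) (τ : absoluteGaloisGroup (v.adicCompletion K)),
      ((τ • b n : localAbsIntegers v) : AlgebraicClosure (v.adicCompletion K)) = τ • z n :=
    fun n τ ↦ integralClosure.coe_smul _ _
  -- the closed sets `S n = {ι ∈ I | ι ζ_n = σ^e ζ_n}`
  let S : ℕ → Set (absoluteGaloisGroup (v.adicCompletion K)) := fun n ↦
    (I : Set (absoluteGaloisGroup (v.adicCompletion K))) ∩ {τ | τ • b n = (σ ^ e) • b n}
  have hSmem : ∀ n τ, τ ∈ S n ↔ τ ∈ I ∧ τ • z n = (σ ^ e) • z n := fun n τ ↦ by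
    change τ ∈ (I : Set (absoluteGaloisGroup (v.adicCompletion K))) ∧ τ • b n = (σ ^ e) • b n ↔ _
    rw [SetLike.mem_coe, Subtype.ext_iff, hb, hb]
  have hIclosed : IsClosed (I : Set (absoluteGaloisGroup (v.adicCompletion K))) := by
    have e : (I : Set (absoluteGaloisGroup (v.adicCompletion K))) =
        ⋂ x : localAbsIntegers v, {g : absoluteGaloisGroup (v.adicCompletion K) | g • x - x ∈ 𝔐} := by
      ext g
      simp only [Set.mem_iInter, SetLike.mem_coe, Set.mem_setOf_eq]
      rfl
    rw [e]
    exact isClosed_iInter fun x ↦ isClosed_setOf_smul_sub_mem_local v 𝔐 x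
  have hclosed : ∀ n, IsClosed (S n) := fun n ↦ by
    refine hIclosed.inter ?_
    letI : TopologicalSpace (localAbsIntegers v) := ⊥
    haveI : DiscreteTopology (localAbsIntegers v) := ⟨rfl⟩
    haveI := absIntegers.continuousSMul (v.adicCompletionIntegers K) (K := v.adicCompletion K)
    have hc : Continuous fun g : absoluteGaloisGroup (v.adicCompletion K) ↦ g • b n :=
      continuous_id.smul continuous_const
    exact (isClosed_discrete {y : localAbsIntegers v | y = (σ ^ e) • b n}).preimage hc
  have hanti : ∀ n, S (n + 1) ⊆ S n := fun n τ hτ ↦ by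
    rw [hSmem] at hτ ⊢
    refine ⟨hτ.1, ?_⟩
    rw [← hzp n, smul_pow', smul_pow', hτ.2]
  have hne : ∀ n, (S n).Nonempty := fun n ↦ by
    obtain ⟨ι, hι, hιz⟩ :=
      exists_mem_inertia_smul_eq_pow_smul_of_isPrimitiveRoot hw h𝔐 hpv hϖ he n (hz n) σ
    exact ⟨ι, (hSmem n ι).mpr ⟨hι, hιz⟩⟩
  obtain ⟨ι, hι⟩ := IsCompact.nonempty_iInter_of_sequence_nonempty_isCompact_isClosed S hanti hne
    (hclosed 0).isCompact hclosed
  have hιI : ι ∈ I := ((hSmem 0 ι).mp (Set.mem_iInter.mp hι 0)).1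
  have hιz : ∀ n, ι • z n = (σ ^ e) • z n := fun n ↦ ((hSmem n ι).mp (Set.mem_iInter.mp hι n)).2
  refine ⟨ι, hιI, fun k ξ hξ ↦ ?_⟩
  cases k with
  | zero =>
    rw [pow_zero, pow_one] at hξ
    rw [hξ, smul_one, smul_one]
  | succ k =>
    obtain ⟨i, -, rfl⟩ := (hz k).eq_pow_of_pow_eq_one hξ
    rw [smul_pow', smul_pow', hιz k]

/-! ## §4 Packaged: `ι · σ^e` fixes `μ_{p^∞}` -/

include hw h𝔐 hpv in
/-- **The inertia group has finite index in the local cyclotomic Galois group.**  At ANY finite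
place `v ∣ p` of a number field `K` (no restriction on the ramification) there is `e ≥ 1` — the
ramification index `e(v ∣ p)` — such that for every `σ ∈ Γ_{K_v}` some `ι` in the inertia group
`I_𝔐` makes `ι·σ^e` fix EVERY `p`-power root of unity of `K̄_v`.  For `σ` an arithmetic Frobenius,
`ι·σ^e` is an element of Frobenius degree `e` acting trivially on `μ_{p^∞}`: the maximal unramified
subextension of `K_v(μ_{p^∞})/K_v` is finite of degree dividing `e` (for `e = 1`:
`exists_isArithFrobAt_forall_smul_eq`, the tower is totally ramified). Neukirch, *ANT*, II (7.13);
Serre, *Local Fields*, IV §4. [cite: NeukirchANT1999, Ch. II (7.13)] [cite: SerreLocalFields1979, Ch. IV §4 Prop. 17–18] -/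
theorem exists_forall_exists_mem_inertia_mul_pow_smul_rootOfUnity_eq :
    ∃ e : ℕ, 1 ≤ e ∧ ∀ σ : absoluteGaloisGroup (v.adicCompletion K),
      ∃ ι ∈ 𝔐.inertia (absoluteGaloisGroup (v.adicCompletion K)),
        ∀ (k : ℕ) (ξ : AlgebraicClosure (v.adicCompletion K)), ξ ^ p ^ k = 1 → (ι * σ ^ e) • ξ = ξ := by
  obtain ⟨ϖ, hϖ⟩ := IsDiscreteValuationRing.exists_irreducible (v.adicCompletionIntegers K)
  obtain ⟨e, he1, he⟩ := exists_one_le_spectralValuation_prime_eq_pow (p := p) hw hpv hϖ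
  refine ⟨e, he1, fun σ ↦ ?_⟩
  obtain ⟨ι, hι, hιz⟩ := exists_mem_inertia_forall_smul_rootOfUnity_eq_pow_smul hw h𝔐 hpv hϖ he σ
  refine ⟨ι⁻¹, (𝔐.inertia _).inv_mem hι, fun k ξ hξ ↦ ?_⟩
  rw [mul_smul, ← hιz k ξ hξ, inv_smul_smul]

end IsDedekindDomain.HeightOneSpectrum

end
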